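import Mathlib
import HarnessLib
import Literature.MathematicalPhysics.QuantumFieldTheory.Balaban1983to89.B10SectCExpansion

/-!
# `Balaban1983to89.B10Eq45LatticeSum` — the one-block lattice sum of **(45)** of T. Bałaban, *Ultraviolet
stability of three-dimensional lattice pure gauge field theories*, Commun. Math. Phys. **102**, 255–275 (1985)
[Balaban1985UV3], evaluated on the ℤ³ model geometry

(Cell numbering B10; journal page = PDF page + 254; read from the page render
`run/shared/lean/pub/pub-balaban/b2b-balaban-ref1/pages/1985-cmp102-uv-stability-3d/1985-cmp102-uv-stability-3d-p013-x2.png`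
(p. 267), re-read 2026-08-20 for this file.)

HONEST FRAMING (mega-formalization `lit-balaban`, verbatim): statement-level skeleton of published theorems with
citation tags; proofs where landed; nothing here is a claim about the Yang–Mills mass gap.

WHY THIS FILE EXISTS.  Unit `lit-balaban-r07` (reader/typer of B10), gen 2.  `B10SectCExpansion.bound45_of_bound44`
(v1.2 of the companion module) kernel-checks the printed inference (44) ⇒ (45) p. 267 [13] (*"By the assumption
n ≥ 2, summation over all Y_j with y fixed yields for g_{k−1} sufficiently small (45)"*) keeping the one-block lattice
sum `Σ_b exp(−κ₁(M₁L^jη)⁻¹|b₋ − y₀|)·(L^jη)⁻¹|b₋ − y₀|` as an abstract bound `Z` — the quantity that print absorbs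
into the *"O(M₁³)"* of (45) (cell census C-B10-1: the power of `M₁` is not load-bearing).  This file EVALUATES it on
the model geometry of (43): sites of the `L^jη`-lattice = ℤ³ in lattice units, `|x − y| = L^jη·‖x − y‖₁` (ℓ¹
lattice distance — a model choice; print does not fix the norm, and an equivalent norm changes only the constants),
bonds = (site, direction) with `b₋ = b.1` (three positively oriented bonds per site):

* `latticeSum45_le` — `Σ_{x ∈ S} e^{−a‖x − y‖₁}‖x − y‖₁ ≤ (2/a)(1 + 4/a)³` for every finite `S ⊂ ℤ³` (`a = κ₁/M₁`);
* `latticeSum45_geometry3` — hence `Z ≤ 3·(2M₁/κ₁)(1 + 4M₁/κ₁)³` for every finite set of bonds, i.e. the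
  hypothesis `hZ` of `bound45_of_bound44` on `latticeGeometry3`;
* `bound45_latticeGeometry3` — (45) with every constant explicit: `CM = 8L²B₃·3(2M₁/κ₁)(1 + 4M₁/κ₁)³`
  (`= O(L²B₃M₁⁴κ₁⁻⁴)` for `κ₁ ≤ M₁`), `O(1) = 2C`.

So the printed `O(M₁³)` is, in this bookkeeping, an `O(M₁⁴κ₁⁻⁴)` (times the absorbed `8L²B₃`): census item C-B10-1
made quantitative; as recorded there, harmless for the argument (`M₁`, `κ₁` are fixed before `g_{k−1}` is taken
small, and (45) is used only through *"g_{k−1} sufficiently small"*).  Ingredients: `t·e^{−bt} ≤ 1/b`, the geometric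
series over ℤ (`Σ_m e^{−b|m|} = (1 + e^{−b})/(1 − e^{−b}) ≤ 1 + 2/b`), the product structure of a box in ℤ³
(`Finset.prod_univ_sum`), fibre counting bonds → sites.  Certified bookkeeping; no content of the series; NOT summit
progress.  SKELETON row B10.Eq45 of `HOME/SKELETON.md` §B10 (PHASE2-NOMINATE of 2026-08-20T23:02Z closed by this file).
-/

namespace Literature.MathematicalPhysics.QuantumFieldTheory.Balaban1983to89.B10Eq45LatticeSum

open Finset
open Literature.MathematicalPhysics.QuantumFieldTheory.Balaban1983to89.B10SectCExpansion

section LatticeSum45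

/-- The ℓ¹ lattice distance on ℤ³ (in lattice units), as a real number — the model reading of `|c_{i,−} − y|/L^jη`
in (43)–(45) pp. 266–267. [cite: Balaban1985UV3, (43) p.266] -/
def l1dist (x y : Fin 3 → ℤ) : ℝ := ∑ i, |((x i - y i : ℤ) : ℝ)|

/-- Lattice distances are non-negative. [cite: Balaban1985UV3, (43) p.266] -/
theorem l1dist_nonneg (x y : Fin 3 → ℤ) : 0 ≤ l1dist x y :=
  Finset.sum_nonneg fun _ _ => abs_nonneg _

/-- `t·e^{−bt} ≤ 1/b` (from `bt + 1 ≤ e^{bt}`). [folklore] -/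
private theorem mul_exp_neg_le {b : ℝ} (hb : 0 < b) (t : ℝ) :
    t * Real.exp (-(b * t)) ≤ 1 / b := by
  have h1 : b * t + 1 ≤ Real.exp (b * t) := Real.add_one_le_exp (b * t)
  have h2 : b * t * Real.exp (-(b * t)) ≤ 1 := by
    calc b * t * Real.exp (-(b * t)) ≤ Real.exp (b * t) * Real.exp (-(b * t)) :=
          mul_le_mul_of_nonneg_right (by linarith) (Real.exp_pos _).le
      _ = 1 := by rw [← Real.exp_add, add_neg_cancel, Real.exp_zero]
  rw [le_div_iff₀ hb]
  linarith [h2]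

/-- `e^{−at}·t ≤ (2/a)·e^{−at/2}`: half of the decay pays for the linear factor of (44). [folklore] -/
private theorem exp_mul_dist_le {a : ℝ} (ha : 0 < a) (t : ℝ) :
    Real.exp (-(a * t)) * t ≤ (2 / a) * Real.exp (-(a / 2 * t)) := by
  have hsplit : Real.exp (-(a * t)) = Real.exp (-(a / 2 * t)) * Real.exp (-(a / 2 * t)) := by
    rw [← Real.exp_add]; congr 1; ring
  have h := mul_exp_neg_le (half_pos ha) t
  have h' : 1 / (a / 2) = 2 / a := one_div_div a 2
  calc Real.exp (-(a * t)) * t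
      = (t * Real.exp (-(a / 2 * t))) * Real.exp (-(a / 2 * t)) := by rw [hsplit]; ring
    _ ≤ (1 / (a / 2)) * Real.exp (-(a / 2 * t)) := mul_le_mul_of_nonneg_right h (Real.exp_pos _).le
    _ = (2 / a) * Real.exp (-(a / 2 * t)) := by rw [h']

/-- `Σ_{m ∈ ℤ} e^{−b|m|} = (1 + e^{−b})/(1 − e^{−b})` for `b > 0` (summability and value; two geometric series,
as in `B6Lemma21Arith.tsum_int_exp_neg_abs` for `b = 1`). [folklore] -/
private theorem tsum_int_exp_neg_mul_abs {b : ℝ} (hb : 0 < b) :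
    Summable (fun m : ℤ => Real.exp (-(b * |(m : ℝ)|))) ∧
      ∑' m : ℤ, Real.exp (-(b * |(m : ℝ)|)) = (1 + Real.exp (-b)) / (1 - Real.exp (-b)) := by
  have hr : Real.exp (-b) < 1 := by rw [Real.exp_lt_one_iff]; linarith
  have hr0 : 0 ≤ Real.exp (-b) := (Real.exp_pos _).le
  have hnat_eq : (fun n : ℕ => Real.exp (-(b * |((n : ℤ) : ℝ)|))) = fun n : ℕ => Real.exp (-b) ^ n := by
    funext n
    rw [← Real.exp_nat_mul]; congr 1
    rw [Int.cast_natCast, abs_of_nonneg (Nat.cast_nonneg n)]; ring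
  have hneg_eq : (fun n : ℕ => Real.exp (-(b * |((-((n : ℤ) + 1) : ℤ) : ℝ)|)))
      = fun n : ℕ => Real.exp (-b) * Real.exp (-b) ^ n := by
    funext n
    rw [← pow_succ', ← Real.exp_nat_mul]; congr 1
    have hc : ((-((n : ℤ) + 1) : ℤ) : ℝ) = -((n : ℝ) + 1) := by push_cast; ring
    rw [hc, abs_neg, abs_of_nonneg (by positivity)]; push_cast; ring
  have hnat : Summable fun n : ℕ => Real.exp (-(b * |((n : ℤ) : ℝ)|)) := by
    rw [hnat_eq]; exact summable_geometric_of_lt_one hr0 hr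
  have hneg : Summable fun n : ℕ => Real.exp (-(b * |((-((n : ℤ) + 1) : ℤ) : ℝ)|)) := by
    rw [hneg_eq]; exact (summable_geometric_of_lt_one hr0 hr).mul_left _
  have h1 : ∑' n : ℕ, Real.exp (-(b * |((n : ℤ) : ℝ)|)) = (1 - Real.exp (-b))⁻¹ := by
    rw [hnat_eq]; exact tsum_geometric_of_lt_one hr0 hr
  have h2 : ∑' n : ℕ, Real.exp (-(b * |((-((n : ℤ) + 1) : ℤ) : ℝ)|))
      = Real.exp (-b) * (1 - Real.exp (-b))⁻¹ := by
    rw [hneg_eq, tsum_mul_left, tsum_geometric_of_lt_one hr0 hr]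
  refine ⟨Summable.of_nat_of_neg_add_one (f := fun z : ℤ => Real.exp (-(b * |(z : ℝ)|))) hnat hneg, ?_⟩
  rw [tsum_of_nat_of_neg_add_one (f := fun z : ℤ => Real.exp (-(b * |(z : ℝ)|))) hnat hneg, h1, h2]
  have hne : 1 - Real.exp (-b) ≠ 0 := by linarith
  field_simp

/-- One-dimensional factor: `Σ_{n ∈ [c−R, c+R]} e^{−b|n − c|} ≤ Σ_{m ∈ ℤ} e^{−b|m|} = 1 + 2e^{−b}/(1 − e^{−b}) ≤
1 + 2/b`. [folklore] -/
private theorem sum_Icc_exp_le {b : ℝ} (hb : 0 < b) (c : ℤ) (R : ℕ) :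
    ∑ n ∈ Finset.Icc (c - R) (c + R), Real.exp (-(b * |((n - c : ℤ) : ℝ)|)) ≤ 1 + 2 / b := by
  obtain ⟨hS, hval0⟩ := tsum_int_exp_neg_mul_abs hb
  set f : ℤ → ℝ := fun m => Real.exp (-(b * |(m : ℝ)|)) with hf
  -- shift n = m + c
  have hshift : ∑ n ∈ Finset.Icc (c - R) (c + R), f (n - c) ≤ ∑' m : ℤ, f m := by
    have hS' : Summable (fun n : ℤ => f (n - c)) := (Equiv.subRight c).summable_iff.mpr hS
    calc ∑ n ∈ Finset.Icc (c - R) (c + R), f (n - c) ≤ ∑' n : ℤ, f (n - c) :=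
          hS'.sum_le_tsum _ (fun n _ => (Real.exp_pos _).le)
      _ = ∑' m : ℤ, f m := (Equiv.subRight c).tsum_eq f
  have hr1 : Real.exp (-b) < 1 := Real.exp_lt_one_iff.mpr (by linarith)
  have htail : Real.exp (-b) / (1 - Real.exp (-b)) ≤ 1 / b := by
    have h : Real.exp (-b) * (b + 1) ≤ 1 := by
      calc Real.exp (-b) * (b + 1) ≤ Real.exp (-b) * Real.exp b :=
            mul_le_mul_of_nonneg_left (by linarith [Real.add_one_le_exp b]) (Real.exp_pos _).le
        _ = 1 := by rw [← Real.exp_add]; simp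
    rw [div_le_div_iff₀ (by linarith) hb]
    nlinarith [h, Real.exp_pos (-b)]
  have hval : (1 + Real.exp (-b)) / (1 - Real.exp (-b)) = 1 + 2 * (Real.exp (-b) / (1 - Real.exp (-b))) := by
    have hne : 1 - Real.exp (-b) ≠ 0 := by linarith
    field_simp
    ring
  calc ∑ n ∈ Finset.Icc (c - R) (c + R), Real.exp (-(b * |((n - c : ℤ) : ℝ)|))
      = ∑ n ∈ Finset.Icc (c - R) (c + R), f (n - c) := rfl
    _ ≤ ∑' m : ℤ, f m := hshift
    _ = (1 + Real.exp (-b)) / (1 - Real.exp (-b)) := hval0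
    _ = 1 + 2 * (Real.exp (-b) / (1 - Real.exp (-b))) := hval
    _ ≤ 1 + 2 * (1 / b) := by linarith [htail]
    _ = 1 + 2 / b := by ring

/-- The pure decay sum over ANY finite set of sites of ℤ³: `Σ_{x ∈ S} e^{−b‖x − y‖₁} ≤ (1 + 2/b)³` (enclose `S`
in a box around `y`; the box sum factorizes, `Finset.prod_univ_sum`).  Certified bookkeeping for the *"summation
over all Y_j with y fixed"* of p. 267. [cite: Balaban1985UV3, (45) p.267] -/
theorem sum_exp_neg_l1dist_le {b : ℝ} (hb : 0 < b) (y : Fin 3 → ℤ) (S : Finset (Fin 3 → ℤ)) :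
    ∑ x ∈ S, Real.exp (-(b * l1dist x y)) ≤ (1 + 2 / b) ^ 3 := by
  classical
  -- a box around y containing S
  set R : ℕ := S.sup fun x => Finset.univ.sup fun i => (x i - y i).natAbs with hR
  set box : Finset (Fin 3 → ℤ) := Fintype.piFinset fun i => Finset.Icc (y i - R) (y i + R) with hbox
  have hsub : S ⊆ box := by
    intro x hx
    rw [hbox, Fintype.mem_piFinset]
    intro i
    have hi : (x i - y i).natAbs ≤ R := by
      rw [hR]
      exact le_trans (Finset.le_sup (f := fun i => (x i - y i).natAbs) (Finset.mem_univ i))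
        (Finset.le_sup (f := fun x => Finset.univ.sup fun i => (x i - y i).natAbs) hx)
    rw [Finset.mem_Icc]
    have hi' : (((x i - y i).natAbs : ℕ) : ℤ) ≤ (R : ℤ) := by exact_mod_cast hi
    rw [Int.natCast_natAbs] at hi'
    obtain ⟨h1, h2⟩ := abs_le.mp hi'
    constructor <;> omega
  have hterm : ∀ x : Fin 3 → ℤ, Real.exp (-(b * l1dist x y)) =
      ∏ i, Real.exp (-(b * |((x i - y i : ℤ) : ℝ)|)) := by
    intro x
    rw [← Real.exp_sum, l1dist, Finset.mul_sum, ← Finset.sum_neg_distrib]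
  calc ∑ x ∈ S, Real.exp (-(b * l1dist x y))
      ≤ ∑ x ∈ box, Real.exp (-(b * l1dist x y)) :=
        Finset.sum_le_sum_of_subset_of_nonneg hsub fun x _ _ => (Real.exp_pos _).le
    _ = ∑ x ∈ box, ∏ i, Real.exp (-(b * |((x i - y i : ℤ) : ℝ)|)) := Finset.sum_congr rfl fun x _ => hterm x
    _ = ∏ i : Fin 3, ∑ n ∈ Finset.Icc (y i - R) (y i + R), Real.exp (-(b * |((n - y i : ℤ) : ℝ)|)) := by
        rw [hbox, Finset.prod_univ_sum]
    _ ≤ ∏ _i : Fin 3, (1 + 2 / b) := by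
        apply Finset.prod_le_prod
        · intro i _; exact Finset.sum_nonneg fun n _ => (Real.exp_pos _).le
        · intro i _; exact sum_Icc_exp_le hb (y i) R
    _ = (1 + 2 / b) ^ 3 := by simp

/-- The one-block lattice sum of (45) over sites of ℤ³, decay rate `a` per lattice unit (= `κ₁/M₁` in (44)):
`Σ_{x ∈ S} e^{−a‖x − y‖₁}‖x − y‖₁ ≤ (2/a)(1 + 4/a)³` for every finite `S` — `O(a⁻⁴)` for `a ≤ 1`.
[cite: Balaban1985UV3, (45) p.267] -/
theorem latticeSum45_le {a : ℝ} (ha : 0 < a) (y : Fin 3 → ℤ) (S : Finset (Fin 3 → ℤ)) :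
    ∑ x ∈ S, Real.exp (-(a * l1dist x y)) * l1dist x y ≤ (2 / a) * (1 + 4 / a) ^ 3 := by
  have h1 : ∀ x ∈ S, Real.exp (-(a * l1dist x y)) * l1dist x y ≤ (2 / a) * Real.exp (-(a / 2 * l1dist x y)) :=
    fun x _ => exp_mul_dist_le ha (l1dist x y)
  have h2 := sum_exp_neg_l1dist_le (half_pos ha) y S
  have h4 : (1 + 2 / (a / 2)) = 1 + 4 / a := by rw [div_div_eq_mul_div]; ring
  calc ∑ x ∈ S, Real.exp (-(a * l1dist x y)) * l1dist x y
      ≤ ∑ x ∈ S, (2 / a) * Real.exp (-(a / 2 * l1dist x y)) := Finset.sum_le_sum h1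
    _ = (2 / a) * ∑ x ∈ S, Real.exp (-(a / 2 * l1dist x y)) := by rw [Finset.mul_sum]
    _ ≤ (2 / a) * (1 + 2 / (a / 2)) ^ 3 := mul_le_mul_of_nonneg_left h2 (by positivity)
    _ = (2 / a) * (1 + 4 / a) ^ 3 := by rw [h4]

/-- Fibre counting: a non-negative site function summed over bonds through `b ↦ b₋`, with at most `m` bonds per
site, is at most `m` times its sum over sites (`Finset.sum_comp`). [folklore] -/
private theorem sum_comp_le_of_fiber_le {B X : Type*} [DecidableEq X] (T : Finset B) (φ : B → X) (f : X → ℝ)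
    (hf : ∀ x, 0 ≤ f x) (m : ℕ) (hm : ∀ x ∈ T.image φ, (T.filter fun b => φ b = x).card ≤ m) :
    ∑ b ∈ T, f (φ b) ≤ m * ∑ x ∈ T.image φ, f x := by
  rw [Finset.sum_comp, Finset.mul_sum]
  refine Finset.sum_le_sum fun x hx => ?_
  rw [nsmul_eq_mul]
  exact mul_le_mul_of_nonneg_right (by exact_mod_cast hm x hx) (hf x)

/-- The same sum in the normalization of `B10SectCExpansion.bound45_of_bound44`'s hypothesis `hZ` (distances
`|x − y| = ℓ·‖x − y‖₁`, `ℓ = L^jη`, decay `exp(−κ₁(M₁ℓ)⁻¹|x − y|)`, linear factor `ℓ⁻¹|x − y|`): over sites,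
`≤ (2M₁/κ₁)(1 + 4M₁/κ₁)³`, uniformly in `ℓ`, `y` and the finite set. [cite: Balaban1985UV3, (45) p.267] -/
theorem latticeSum45_scaled {κ₁ M₁ ℓ : ℝ} (hκ : 0 < κ₁) (hM : 0 < M₁) (hℓ : 0 < ℓ) (y : Fin 3 → ℤ)
    (S : Finset (Fin 3 → ℤ)) :
    ∑ x ∈ S, Real.exp (-(κ₁ * (M₁ * ℓ)⁻¹ * (ℓ * l1dist x y))) * (ℓ⁻¹ * (ℓ * l1dist x y)) ≤
      (2 * M₁ / κ₁) * (1 + 4 * M₁ / κ₁) ^ 3 := by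
  have ha : 0 < κ₁ / M₁ := div_pos hκ hM
  have hℓ0 : ℓ ≠ 0 := hℓ.ne'
  have hM0 : M₁ ≠ 0 := hM.ne'
  have hκ0 : κ₁ ≠ 0 := hκ.ne'
  have hre : ∀ x, Real.exp (-(κ₁ * (M₁ * ℓ)⁻¹ * (ℓ * l1dist x y))) * (ℓ⁻¹ * (ℓ * l1dist x y)) =
      Real.exp (-(κ₁ / M₁ * l1dist x y)) * l1dist x y := by
    intro x
    congr 1
    · congr 1; field_simp
    · field_simp
  rw [Finset.sum_congr rfl fun x _ => hre x]
  have h := latticeSum45_le ha y S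
  have e1 : 2 / (κ₁ / M₁) = 2 * M₁ / κ₁ := by field_simp
  have e2 : 4 / (κ₁ / M₁) = 4 * M₁ / κ₁ := by field_simp
  rw [e1, e2] at h
  exact h

/-- The model geometry of (43)–(45) in d = 3 at scale `ℓ = L^jη`, as a `B10SectCExpansion.VertexGeometry`: sites =
ℤ³ (the `L^jη`-lattice in lattice units), bonds = (site, direction) with `b₋ = b.1` (p. 266: *"c_i are bonds in
Ω_k^{(j)}"*, `c_{i,−}` their initial points), `dist x y = ℓ·‖x − y‖₁`; the tree length `𝓛` of (56)–(57) is a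
parameter `treeLen` (not used by (43)–(45)).  A definition with body. [cite: Balaban1985UV3, (43) p.266] -/
def latticeGeometry3 (ℓ : ℝ) (treeLen : Set ((Fin 3 → ℤ) × Fin 3) → Set (Fin 3 → ℤ) → ℝ) : VertexGeometry where
  Bond := (Fin 3 → ℤ) × Fin 3
  Site := Fin 3 → ℤ
  treeLen := treeLen
  cminus := Prod.fst
  dist x y := ℓ * l1dist x y

/-- At most three (positively oriented) bonds start at a site: the fibre of `b ↦ b₋ = b.1` over a site has
at most `#(Fin 3) = 3` elements. [folklore] -/
private theorem card_fiber_fst_le_three (T : Finset ((Fin 3 → ℤ) × Fin 3)) (x : Fin 3 → ℤ) :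
    (T.filter fun b => b.1 = x).card ≤ 3 := by
  classical
  calc (T.filter fun b => b.1 = x).card
      ≤ (Finset.univ.image fun i : Fin 3 => (x, i)).card := by
        apply Finset.card_le_card
        intro b hb
        rw [Finset.mem_filter] at hb
        rw [Finset.mem_image]
        exact ⟨b.2, Finset.mem_univ _, by rw [← hb.2]⟩
    _ ≤ (Finset.univ : Finset (Fin 3)).card := Finset.card_image_le
    _ = 3 := by simp

/-- The hypothesis `hZ` of `B10SectCExpansion.bound45_of_bound44` DISCHARGED on the model geometry
`latticeGeometry3 ℓ`: for every block `y₀` and every finite set `adm y₀` of admissible bonds (print: those with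
`|c₋ − y₀| < R(g_j)M₁L^jη`; here ANY finite set),
`Σ_{b ∈ adm y₀} exp(−κ₁(M₁ℓ)⁻¹|b₋ − y₀|)·ℓ⁻¹|b₋ − y₀| ≤ 3·(2M₁/κ₁)(1 + 4M₁/κ₁)³` (three bonds per site × the site sum
`latticeSum45_scaled`).  This is the quantity print absorbs into the *"O(M₁³)"* of (45); in this bookkeeping it is
`O(M₁⁴κ₁⁻⁴)` for `κ₁ ≤ M₁` (cell census C-B10-1 made quantitative; not load-bearing). [cite: Balaban1985UV3, (45) p.267] -/
theorem latticeSum45_geometry3 {κ₁ M₁ ℓ : ℝ} (hκ : 0 < κ₁) (hM : 0 < M₁) (hℓ : 0 < ℓ)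
    (treeLen : Set ((Fin 3 → ℤ) × Fin 3) → Set (Fin 3 → ℤ) → ℝ)
    (adm : (Fin 3 → ℤ) → Finset ((Fin 3 → ℤ) × Fin 3)) (y₀ : Fin 3 → ℤ) :
    ∑ b ∈ adm y₀, Real.exp (-(κ₁ * (M₁ * ℓ)⁻¹ * (latticeGeometry3 ℓ treeLen).dist
        ((latticeGeometry3 ℓ treeLen).cminus b) y₀)) *
      (ℓ⁻¹ * (latticeGeometry3 ℓ treeLen).dist ((latticeGeometry3 ℓ treeLen).cminus b) y₀) ≤
      3 * ((2 * M₁ / κ₁) * (1 + 4 * M₁ / κ₁) ^ 3) := by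
  classical
  set f : (Fin 3 → ℤ) → ℝ := fun x =>
    Real.exp (-(κ₁ * (M₁ * ℓ)⁻¹ * (ℓ * l1dist x y₀))) * (ℓ⁻¹ * (ℓ * l1dist x y₀)) with hf
  have hf0 : ∀ x, 0 ≤ f x := by
    intro x
    have := l1dist_nonneg x y₀
    positivity
  have hfib := sum_comp_le_of_fiber_le (adm y₀) Prod.fst f hf0 3 (fun x _ => card_fiber_fst_le_three _ x)
  have hsite := latticeSum45_scaled hκ hM hℓ y₀ ((adm y₀).image Prod.fst)
  calc _ = ∑ b ∈ adm y₀, f b.1 := rfl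
    _ ≤ 3 * ∑ x ∈ (adm y₀).image Prod.fst, f x := by exact_mod_cast hfib
    _ ≤ 3 * ((2 * M₁ / κ₁) * (1 + 4 * M₁ / κ₁) ^ 3) :=
        mul_le_mul_of_nonneg_left hsite (by norm_num)

/-- **(45) p. 267 [13] with every constant explicit on the ℤ³ model geometry**: under (44)
(`B10SectCExpansion.Bound44` with `C ≥ 0` on `latticeGeometry3 ℓ`), the degree floor `n ≥ 2` of (43), signs, and the
single smallness condition `8L²B₃·Z₃·g p(g)·ℓ² ≤ ½` with `Z₃ = 3(2M₁/κ₁)(1 + 4M₁/κ₁)³` (*"for g_{k−1} sufficiently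
small"*; scale-free form `B10SectCExpansion.smallness45_of_scaleFree`), the block sums satisfy (45) in the typed
shape `B10SectCExpansion.Bound45` with `CM = 8L²B₃·Z₃` and `O(1) = 2C` — no abstract lattice-sum hypothesis left.
Certified bookkeeping (`bound45_of_bound44` + `latticeSum45_geometry3`); no content of the series.
[cite: Balaban1985UV3, (44)–(45) p.267] -/
theorem bound45_latticeGeometry3 {κ₁ M₁ ℓ L B₃ g pg C : ℝ} (hκ : 0 < κ₁) (hM : 0 < M₁) (hℓ : 0 < ℓ)
    (hC : 0 ≤ C) (hB : 0 ≤ B₃) (hg : 0 ≤ g) (hpg : 0 ≤ pg)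
    (treeLen : Set ((Fin 3 → ℤ) × Fin 3) → Set (Fin 3 → ℤ) → ℝ)
    (PU : TermSizes (latticeGeometry3 ℓ treeLen)) (adm : (Fin 3 → ℤ) → Finset ((Fin 3 → ℤ) × Fin 3)) (N : ℕ)
    (h44 : Bound44 (latticeGeometry3 ℓ treeLen) PU κ₁ M₁ ℓ L B₃ g pg C)
    (hfloor : ∀ (y : Fin 3 → ℤ) (n : ℕ) (c : Fin n → (Fin 3 → ℤ) × Fin 3), PU y n c ≠ 0 → 2 ≤ n)
    (hsmall : 8 * L ^ 2 * B₃ * (3 * ((2 * M₁ / κ₁) * (1 + 4 * M₁ / κ₁) ^ 3)) * g * pg * ℓ ^ 2 ≤ 1 / 2) :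
    Bound45 (latticeGeometry3 ℓ treeLen) (blockSum45 (latticeGeometry3 ℓ treeLen) PU adm N)
      (8 * L ^ 2 * B₃ * (3 * ((2 * M₁ / κ₁) * (1 + 4 * M₁ / κ₁) ^ 3))) g pg ℓ (2 * C) :=
  bound45_of_bound44 (latticeGeometry3 ℓ treeLen) PU adm N hC hℓ hB hg hpg
    (fun x y => mul_nonneg hℓ.le (l1dist_nonneg x y)) h44 hfloor
    (latticeSum45_geometry3 hκ hM hℓ treeLen adm) hsmall

end LatticeSum45

end Literature.MathematicalPhysics.QuantumFieldTheory.Balaban1983to89.B10Eq45LatticeSum
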